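import Mathlib
import Literature.Analysis.UnboundedOperators.ConjugateOperatorRegularity
import HarnessLib
import Summits.AtomisticToContinuum.FouriersLaw.Theorems.EmbeddedDrudeMourreMourreDissolutionLAPDissipativeResolvent

/-!
# Stub `stub_mourreThresholdLAP` — F1b: Mourre's dissipative resolvent family, identities

Item `stmt-AtomisticToContinuum-12594` (crux `MourreDissolution` of route `EmbeddedDrudeMourre`,
sub-problem `FouriersLaw`), line `separable-vertex-faddeev-pair-sector`, stub S6
`stub_mourreThresholdLAP` (Mourre's limiting absorption principle, `C²` form), helper F1 of the
proof map (Mourre 1981; ABG = Amrein–Boutet de Monvel–Georgescu 1996, Lemmas 7.3.3–7.3.4, here for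
unbounded `H` through its bounded resolvent), part 2/3, over
`…LAPDissipativeResolvent` (notation `R(z)`, `K`, `K̃`, `Kinv`, `G = R(z) Kinv`, dissipative `M`,
`ε · Im z ≤ 0` as there).

* §1 `Kinv = 1 - iε M G = 1 - iε Kinv M R(z)`, `R(z) - G = iε R(z) M G = iε G M R(z)`,
  `‖G - R(z)‖ ≤ |ε| ‖R(z)‖ ‖M‖ ‖G‖ ≤ |ε| ‖M‖ / |Im z|²` (so `G_ε(z) → R(z)` as `ε → 0`);
* §2 push-through: `K̃ G = R(z)`, `K̃` is a unit with `K̃⁻¹ = 1 - iε G M`, `G = K̃⁻¹ R(z)`;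
* §3 `G` against the Hamiltonian: `G h ∈ D(H)` with `H (G h) = h - iε M (G h) + z G h`
  (`(H - z + iεM) G = 1`), `G ((H - z) x + iε M x) = x` on `D(H)`, and the dissipation identity
  `Im ⟪h, G h⟫ = Im z ‖G h‖² - ε Re ⟪G h, M G h⟫`;
* §4 the resolvent identities `G_ε(z₁) - G_ε(z₂) = (z₁ - z₂) G_ε(z₁) G_ε(z₂)` (headline
  `mourreG_dissipative_resolvent_identity`) and `G_{ε₁} - G_{ε₂} = -i(ε₁ - ε₂) G_{ε₁} M G_{ε₂}`,
  with the Lipschitz bounds `|z₁ - z₂| / (|Im z₁| |Im z₂|)` and `|ε₁ - ε₂| ‖M‖ / |Im z|²`.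
-/

noncomputable section

open MeasureTheory Complex Filter Topology Set
open scoped InnerProductSpace ComplexConjugate ENNReal NNReal

namespace Summit.AtomisticToContinuum.FouriersLaw.Theorems.MourreDissolution

open Literature.Analysis.UnboundedOperators
open Literature.Analysis.UnboundedOperators.UnitaryRep

variable {H : Type*} [NormedAddCommGroup H] [InnerProductSpace ℂ H] [CompleteSpace H]

/-! ## §1. `Kinv`, `R(z) - G`, and `G → R(z)` -/

/-- **`Kinv = 1 - iε M G`** (from `K Kinv = 1`).
[cite: AmreinBoutetdeMonvelGeorgescu1996, Lemma 7.3.3] -/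
theorem mourreKinv_eq {M : H →L[ℂ] H} (hM : ∀ f : H, 0 ≤ (⟪f, M f⟫_ℂ).re)
    {z : ℂ} (hz : z.im ≠ 0) {ε : ℝ} (hεz : ε * z.im ≤ 0) (U : OneParameterUnitaryGroup H) :
    mourreKinv U M ε z = 1 - ((I : ℂ) * ε) • (M * mourreG U M ε z) := by
  have h := mourreK_mul_mourreKinv hM hz hεz U
  rw [mourreK, add_mul, one_mul, smul_mul_assoc, mul_assoc] at h
  rw [mourreG]
  exact eq_sub_of_add_eq h

/-- `Kinv = 1 - iε Kinv M R(z)` (from `Kinv K = 1`).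
[cite: AmreinBoutetdeMonvelGeorgescu1996, Lemma 7.3.3] -/
theorem mourreKinv_eq' {M : H →L[ℂ] H} (hM : ∀ f : H, 0 ≤ (⟪f, M f⟫_ℂ).re)
    {z : ℂ} (hz : z.im ≠ 0) {ε : ℝ} (hεz : ε * z.im ≤ 0) (U : OneParameterUnitaryGroup H) :
    mourreKinv U M ε z = 1 - ((I : ℂ) * ε) • (mourreKinv U M ε z * M * resolventAt U z) := by
  have h := mourreKinv_mul_mourreK hM hz hεz U
  rw [mourreK, mul_add, mul_one, mul_smul_comm, ← mul_assoc] at h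
  exact eq_sub_of_add_eq h

/-- `Kinv h = h - iε M (G h)`. [folklore] -/
theorem mourreKinv_apply {M : H →L[ℂ] H} (hM : ∀ f : H, 0 ≤ (⟪f, M f⟫_ℂ).re)
    {z : ℂ} (hz : z.im ≠ 0) {ε : ℝ} (hεz : ε * z.im ≤ 0) (U : OneParameterUnitaryGroup H) (h : H) :
    mourreKinv U M ε z h = h - ((I : ℂ) * ε) • M (mourreG U M ε z h) := by
  conv_lhs => rw [mourreKinv_eq hM hz hεz U]
  simp

/-- **`R(z) - G = iε R(z) M G`** (second resolvent identity, right form).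
[cite: AmreinBoutetdeMonvelGeorgescu1996, Lemma 7.3.3] -/
theorem resolventAt_sub_mourreG {M : H →L[ℂ] H} (hM : ∀ f : H, 0 ≤ (⟪f, M f⟫_ℂ).re)
    {z : ℂ} (hz : z.im ≠ 0) {ε : ℝ} (hεz : ε * z.im ≤ 0) (U : OneParameterUnitaryGroup H) :
    resolventAt U z - mourreG U M ε z = ((I : ℂ) * ε) • (resolventAt U z * M * mourreG U M ε z) := by
  conv_lhs => rw [mourreG, mourreKinv_eq hM hz hεz U]
  rw [mul_sub, mul_one, sub_sub_cancel, mul_smul_comm, mul_assoc]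

/-- **`R(z) - G = iε G M R(z)`** (second resolvent identity, left form).
[cite: AmreinBoutetdeMonvelGeorgescu1996, Lemma 7.3.3] -/
theorem resolventAt_sub_mourreG' {M : H →L[ℂ] H} (hM : ∀ f : H, 0 ≤ (⟪f, M f⟫_ℂ).re)
    {z : ℂ} (hz : z.im ≠ 0) {ε : ℝ} (hεz : ε * z.im ≤ 0) (U : OneParameterUnitaryGroup H) :
    resolventAt U z - mourreG U M ε z = ((I : ℂ) * ε) • (mourreG U M ε z * M * resolventAt U z) := by
  conv_lhs => rw [mourreG, mourreKinv_eq' hM hz hεz U]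
  rw [mul_sub, mul_one, sub_sub_cancel, mul_smul_comm, mourreG, ← mul_assoc, ← mul_assoc]

/-- `‖G - R(z)‖ ≤ |ε| ‖R(z)‖ ‖M‖ ‖G‖` (so `G_ε(z) → R(z)` in norm as `ε → 0` at fixed `z`, by
`‖G‖ ≤ 1/|Im z|`). [cite: AmreinBoutetdeMonvelGeorgescu1996, Lemma 7.3.3] -/
theorem norm_mourreG_sub_resolventAt_le {M : H →L[ℂ] H} (hM : ∀ f : H, 0 ≤ (⟪f, M f⟫_ℂ).re)
    {z : ℂ} (hz : z.im ≠ 0) {ε : ℝ} (hεz : ε * z.im ≤ 0) (U : OneParameterUnitaryGroup H) :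
    ‖mourreG U M ε z - resolventAt U z‖ ≤ |ε| * ‖resolventAt U z‖ * ‖M‖ * ‖mourreG U M ε z‖ := by
  rw [norm_sub_rev, resolventAt_sub_mourreG hM hz hεz U, norm_smul, norm_mul, Complex.norm_I,
    one_mul, Complex.norm_real, Real.norm_eq_abs]
  have h3 : ‖resolventAt U z * M * mourreG U M ε z‖ ≤ ‖resolventAt U z‖ * ‖M‖ * ‖mourreG U M ε z‖ :=
    (norm_mul_le _ _).trans (mul_le_mul_of_nonneg_right (norm_mul_le _ _) (norm_nonneg _))
  calc |ε| * ‖resolventAt U z * M * mourreG U M ε z‖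
      ≤ |ε| * (‖resolventAt U z‖ * ‖M‖ * ‖mourreG U M ε z‖) := by gcongr
    _ = _ := by ring

/-- `‖G_ε(z) - R(z)‖ ≤ |ε| ‖M‖ / |Im z|²`. [cite: AmreinBoutetdeMonvelGeorgescu1996, Lemma 7.3.3] -/
theorem norm_mourreG_sub_resolventAt_le' {M : H →L[ℂ] H} (hM : ∀ f : H, 0 ≤ (⟪f, M f⟫_ℂ).re)
    {z : ℂ} (hz : z.im ≠ 0) {ε : ℝ} (hεz : ε * z.im ≤ 0) (U : OneParameterUnitaryGroup H) :
    ‖mourreG U M ε z - resolventAt U z‖ ≤ |ε| * ‖M‖ * (|z.im|⁻¹ * |z.im|⁻¹) := by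
  calc ‖mourreG U M ε z - resolventAt U z‖
      ≤ |ε| * ‖resolventAt U z‖ * ‖M‖ * ‖mourreG U M ε z‖ := norm_mourreG_sub_resolventAt_le hM hz hεz U
    _ ≤ |ε| * |z.im|⁻¹ * ‖M‖ * |z.im|⁻¹ := by
        gcongr
        · exact norm_resolventAt_le_inv_abs hz U
        · exact norm_mourreG_le hM hz hεz U
    _ = |ε| * ‖M‖ * (|z.im|⁻¹ * |z.im|⁻¹) := by ring

/-! ## §2. Push-through: `K̃` and its inverse -/

/-- `K̃ G = R(z)` (`K̃ R = R K` and `K Kinv = 1`).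
[cite: AmreinBoutetdeMonvelGeorgescu1996, Lemma 7.3.3] -/
theorem mourreKt_mul_mourreG {M : H →L[ℂ] H} (hM : ∀ f : H, 0 ≤ (⟪f, M f⟫_ℂ).re)
    {z : ℂ} (hz : z.im ≠ 0) {ε : ℝ} (hεz : ε * z.im ≤ 0) (U : OneParameterUnitaryGroup H) :
    mourreKt U M ε z * mourreG U M ε z = resolventAt U z := by
  rw [mourreG, ← mul_assoc, mourreKt_mul_resolventAt, mul_assoc, mourreK_mul_mourreKinv hM hz hεz U,
    mul_one]

/-- `G M K̃ = R(z) M` (from `R - G = iε G M R`).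
[cite: AmreinBoutetdeMonvelGeorgescu1996, Lemma 7.3.3] -/
theorem mourreG_mul_mul_mourreKt {M : H →L[ℂ] H} (hM : ∀ f : H, 0 ≤ (⟪f, M f⟫_ℂ).re)
    {z : ℂ} (hz : z.im ≠ 0) {ε : ℝ} (hεz : ε * z.im ≤ 0) (U : OneParameterUnitaryGroup H) :
    mourreG U M ε z * M * mourreKt U M ε z = resolventAt U z * M := by
  have hD := resolventAt_sub_mourreG' hM hz hεz U
  rw [sub_eq_iff_eq_add'] at hD
  rw [mourreKt, mul_add, mul_one, mul_smul_comm, ← mul_assoc]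
  conv_rhs => rw [hD, add_mul, smul_mul_assoc]

/-- `K̃ (1 - iε G M) = 1`. [cite: AmreinBoutetdeMonvelGeorgescu1996, Lemma 7.3.3] -/
theorem mourreKt_mul_one_sub {M : H →L[ℂ] H} (hM : ∀ f : H, 0 ≤ (⟪f, M f⟫_ℂ).re)
    {z : ℂ} (hz : z.im ≠ 0) {ε : ℝ} (hεz : ε * z.im ≤ 0) (U : OneParameterUnitaryGroup H) :
    mourreKt U M ε z * (1 - ((I : ℂ) * ε) • (mourreG U M ε z * M)) = 1 := by
  rw [mul_sub, mul_one, mul_smul_comm, ← mul_assoc, mourreKt_mul_mourreG hM hz hεz U, mourreKt,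
    add_sub_cancel_right]

/-- `(1 - iε G M) K̃ = 1`. [cite: AmreinBoutetdeMonvelGeorgescu1996, Lemma 7.3.3] -/
theorem one_sub_mul_mourreKt {M : H →L[ℂ] H} (hM : ∀ f : H, 0 ≤ (⟪f, M f⟫_ℂ).re)
    {z : ℂ} (hz : z.im ≠ 0) {ε : ℝ} (hεz : ε * z.im ≤ 0) (U : OneParameterUnitaryGroup H) :
    (1 - ((I : ℂ) * ε) • (mourreG U M ε z * M)) * mourreKt U M ε z = 1 := by
  rw [sub_mul, one_mul, smul_mul_assoc, mourreG_mul_mul_mourreKt hM hz hεz U, mourreKt,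
    add_sub_cancel_right]

/-- **`K̃_ε(z)` is invertible** with inverse `1 - iε G M`.
[cite: AmreinBoutetdeMonvelGeorgescu1996, Lemma 7.3.3] -/
theorem isUnit_mourreKt {M : H →L[ℂ] H} (hM : ∀ f : H, 0 ≤ (⟪f, M f⟫_ℂ).re)
    {z : ℂ} (hz : z.im ≠ 0) {ε : ℝ} (hεz : ε * z.im ≤ 0) (U : OneParameterUnitaryGroup H) :
    IsUnit (mourreKt U M ε z) :=
  ⟨⟨_, _, mourreKt_mul_one_sub hM hz hεz U, one_sub_mul_mourreKt hM hz hεz U⟩, rfl⟩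

/-- **`K̃⁻¹ = 1 - iε G M`.** [cite: AmreinBoutetdeMonvelGeorgescu1996, Lemma 7.3.3] -/
theorem mourreKtinv_eq {M : H →L[ℂ] H} (hM : ∀ f : H, 0 ≤ (⟪f, M f⟫_ℂ).re)
    {z : ℂ} (hz : z.im ≠ 0) {ε : ℝ} (hεz : ε * z.im ≤ 0) (U : OneParameterUnitaryGroup H) :
    mourreKtinv U M ε z = 1 - ((I : ℂ) * ε) • (mourreG U M ε z * M) :=
  Ring.inverse_unit ⟨_, _, mourreKt_mul_one_sub hM hz hεz U, one_sub_mul_mourreKt hM hz hεz U⟩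

/-- `K̃ K̃inv = 1`. [cite: AmreinBoutetdeMonvelGeorgescu1996, Lemma 7.3.3] -/
theorem mourreKt_mul_mourreKtinv {M : H →L[ℂ] H} (hM : ∀ f : H, 0 ≤ (⟪f, M f⟫_ℂ).re)
    {z : ℂ} (hz : z.im ≠ 0) {ε : ℝ} (hεz : ε * z.im ≤ 0) (U : OneParameterUnitaryGroup H) :
    mourreKt U M ε z * mourreKtinv U M ε z = 1 :=
  Ring.mul_inverse_cancel _ (isUnit_mourreKt hM hz hεz U)

/-- `K̃inv K̃ = 1`. [cite: AmreinBoutetdeMonvelGeorgescu1996, Lemma 7.3.3] -/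
theorem mourreKtinv_mul_mourreKt {M : H →L[ℂ] H} (hM : ∀ f : H, 0 ≤ (⟪f, M f⟫_ℂ).re)
    {z : ℂ} (hz : z.im ≠ 0) {ε : ℝ} (hεz : ε * z.im ≤ 0) (U : OneParameterUnitaryGroup H) :
    mourreKtinv U M ε z * mourreKt U M ε z = 1 :=
  Ring.inverse_mul_cancel _ (isUnit_mourreKt hM hz hεz U)

/-- **Push-through: `G = K̃⁻¹ R(z)`**, i.e. `R (1 + iεMR)⁻¹ = (1 + iεRM)⁻¹ R`.
[cite: AmreinBoutetdeMonvelGeorgescu1996, Lemma 7.3.3] -/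
theorem mourreG_eq_mourreKtinv_mul {M : H →L[ℂ] H} (hM : ∀ f : H, 0 ≤ (⟪f, M f⟫_ℂ).re)
    {z : ℂ} (hz : z.im ≠ 0) {ε : ℝ} (hεz : ε * z.im ≤ 0) (U : OneParameterUnitaryGroup H) :
    mourreG U M ε z = mourreKtinv U M ε z * resolventAt U z := by
  rw [← mourreKt_mul_mourreG hM hz hεz U, ← mul_assoc, mourreKtinv_mul_mourreKt hM hz hεz U, one_mul]

/-! ## §3. `G` against the Hamiltonian -/

/-- **`G h ∈ D(H)` and `H (G h) = h - iε M (G h) + z G h`**, i.e. `(H - z + iεM) G = 1` on the whole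
space. [cite: AmreinBoutetdeMonvelGeorgescu1996, Lemma 7.3.3] -/
theorem mourreG_mem_hamiltonian_domain {M : H →L[ℂ] H} (hM : ∀ f : H, 0 ≤ (⟪f, M f⟫_ℂ).re)
    {z : ℂ} (hz : z.im ≠ 0) {ε : ℝ} (hεz : ε * z.im ≤ 0) (U : OneParameterUnitaryGroup H) (h : H) :
    ∃ hd : mourreG U M ε z h ∈ U.hamiltonian.domain,
      U.hamiltonian ⟨mourreG U M ε z h, hd⟩ =
        h - ((I : ℂ) * ε) • M (mourreG U M ε z h) + z • mourreG U M ε z h := by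
  obtain ⟨hd, hH⟩ := resolventAt_mem_hamiltonian_domain hz U (mourreKinv U M ε z h)
  refine ⟨hd, ?_⟩
  rw [show (⟨mourreG U M ε z h, hd⟩ : U.hamiltonian.domain) =
      ⟨resolventAt U z (mourreKinv U M ε z h), hd⟩ from rfl, hH, ← mourreG_apply,
    mourreKinv_apply hM hz hεz U h]

/-- **`G ((H - z) x + iε M x) = x` for `x ∈ D(H)`**, i.e. `G (H - z + iεM) = 1` on `D(H)`.
[cite: AmreinBoutetdeMonvelGeorgescu1996, Lemma 7.3.3] -/
theorem mourreG_apply_hamiltonian {M : H →L[ℂ] H} (hM : ∀ f : H, 0 ≤ (⟪f, M f⟫_ℂ).re)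
    {z : ℂ} (hz : z.im ≠ 0) {ε : ℝ} (hεz : ε * z.im ≤ 0) (U : OneParameterUnitaryGroup H)
    (x : U.hamiltonian.domain) :
    mourreG U M ε z (U.hamiltonian x - z • (x : H) + ((I : ℂ) * ε) • M x) = x := by
  rw [mourreG_eq_mourreKtinv_mul hM hz hεz U, mul_apply_eq_comp, map_add,
    resolventAt_hamiltonian_sub_of_ne hz U x, map_smul, ← mourreKt_apply, ← mul_apply_eq_comp,
    mourreKtinv_mul_mourreKt hM hz hεz U, one_apply_eq_self]

/-- **Dissipation identity for `G`**: `Im ⟪h, G h⟫ = Im z ‖G h‖² - ε Re ⟪G h, M (G h)⟫` (so for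
`Im z = -ν < 0 ≤ ε`: `ν ‖G h‖² + ε Re ⟪G h, M G h⟫ = -Im ⟪h, G h⟫ ≤ ‖h‖ ‖G h‖`, the mechanism of the
a-priori and quadratic estimates ABG (7.3.4)–(7.3.5)).
[cite: AmreinBoutetdeMonvelGeorgescu1996, Lemma 7.3.3] -/
theorem im_inner_mourreG {M : H →L[ℂ] H} (hM : ∀ f : H, 0 ≤ (⟪f, M f⟫_ℂ).re)
    {z : ℂ} (hz : z.im ≠ 0) {ε : ℝ} (hεz : ε * z.im ≤ 0) (U : OneParameterUnitaryGroup H) (h : H) :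
    (⟪h, mourreG U M ε z h⟫_ℂ).im =
      z.im * ‖mourreG U M ε z h‖ ^ 2 -
        ε * (⟪mourreG U M ε z h, M (mourreG U M ε z h)⟫_ℂ).re := by
  have key := im_inner_mourreK_resolventAt hz U M ε (mourreKinv U M ε z h)
  rw [mourreK_mourreKinv_apply hM hz hεz U, ← mourreG_apply] at key
  rw [key]
  congr 2
  rw [← RCLike.re_to_complex, inner_re_symm, RCLike.re_to_complex]

/-! ## §4. Resolvent identities in `z` and in `ε` -/

/-- **First resolvent identity for `G` in `z`**: `G_ε(z₁) - G_ε(z₂) = (z₁ - z₂) G_ε(z₁) G_ε(z₂)`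
(`g = G_ε(z₂) h ∈ D(H)` solves `(H - z₂ + iεM) g = h`, so `(H - z₁ + iεM) g = h - (z₁ - z₂) g` and
`g = G_ε(z₁) h - (z₁ - z₂) G_ε(z₁) g`). [folklore] -/
theorem mourreG_sub_mourreG {M : H →L[ℂ] H} (hM : ∀ f : H, 0 ≤ (⟪f, M f⟫_ℂ).re) {z₁ z₂ : ℂ}
    (hz₁ : z₁.im ≠ 0) (hz₂ : z₂.im ≠ 0) {ε : ℝ} (hε₁ : ε * z₁.im ≤ 0) (hε₂ : ε * z₂.im ≤ 0)
    (U : OneParameterUnitaryGroup H) :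
    mourreG U M ε z₁ - mourreG U M ε z₂ = (z₁ - z₂) • (mourreG U M ε z₁ * mourreG U M ε z₂) := by
  refine ContinuousLinearMap.ext fun h => ?_
  obtain ⟨hd, hH⟩ := mourreG_mem_hamiltonian_domain hM hz₂ hε₂ U h
  have key := mourreG_apply_hamiltonian hM hz₁ hε₁ U ⟨mourreG U M ε z₂ h, hd⟩
  rw [hH] at key
  have e : h - ((I : ℂ) * ε) • M (mourreG U M ε z₂ h) + z₂ • mourreG U M ε z₂ h -
      z₁ • mourreG U M ε z₂ h + ((I : ℂ) * ε) • M (mourreG U M ε z₂ h) =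
      h - (z₁ - z₂) • mourreG U M ε z₂ h := by
    rw [sub_smul]; abel
  rw [e, map_sub, map_smul] at key
  rw [sub_apply, smul_apply, mul_apply_eq_comp]
  calc mourreG U M ε z₁ h - mourreG U M ε z₂ h
      = mourreG U M ε z₁ h - (mourreG U M ε z₁ h - (z₁ - z₂) • mourreG U M ε z₁ (mourreG U M ε z₂ h)) := by
        rw [key]
    _ = (z₁ - z₂) • mourreG U M ε z₁ (mourreG U M ε z₂ h) := by abel

/-- **Lipschitz bound in `z`**: `‖G_ε(z₁) - G_ε(z₂)‖ ≤ |z₁ - z₂| / (|Im z₁| |Im z₂|)`.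
[folklore] -/
theorem norm_mourreG_sub_mourreG_le {M : H →L[ℂ] H} (hM : ∀ f : H, 0 ≤ (⟪f, M f⟫_ℂ).re)
    {z₁ z₂ : ℂ} (hz₁ : z₁.im ≠ 0) (hz₂ : z₂.im ≠ 0) {ε : ℝ} (hε₁ : ε * z₁.im ≤ 0)
    (hε₂ : ε * z₂.im ≤ 0) (U : OneParameterUnitaryGroup H) :
    ‖mourreG U M ε z₁ - mourreG U M ε z₂‖ ≤ ‖z₁ - z₂‖ * (|z₁.im|⁻¹ * |z₂.im|⁻¹) := by
  rw [mourreG_sub_mourreG hM hz₁ hz₂ hε₁ hε₂ U, norm_smul]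
  gcongr
  exact (norm_mul_le _ _).trans (mul_le_mul (norm_mourreG_le hM hz₁ hε₁ U)
    (norm_mourreG_le hM hz₂ hε₂ U) (norm_nonneg _) (by positivity))

/-- **Second resolvent identity for `G` in `ε`**:
`G_{ε₁}(z) - G_{ε₂}(z) = -i(ε₁ - ε₂) G_{ε₁}(z) M G_{ε₂}(z)` (`g = G_{ε₂} h` solves
`(H - z + iε₁M) g = h + i(ε₁ - ε₂) M g`). [cite: AmreinBoutetdeMonvelGeorgescu1996, Lemma 7.3.4] -/
theorem mourreG_sub_mourreG_of_eps {M : H →L[ℂ] H} (hM : ∀ f : H, 0 ≤ (⟪f, M f⟫_ℂ).re) {z : ℂ}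
    (hz : z.im ≠ 0) {ε₁ ε₂ : ℝ} (hε₁ : ε₁ * z.im ≤ 0) (hε₂ : ε₂ * z.im ≤ 0)
    (U : OneParameterUnitaryGroup H) :
    mourreG U M ε₁ z - mourreG U M ε₂ z =
      -((I : ℂ) * ((ε₁ - ε₂ : ℝ) : ℂ)) • (mourreG U M ε₁ z * M * mourreG U M ε₂ z) := by
  refine ContinuousLinearMap.ext fun h => ?_
  obtain ⟨hd, hH⟩ := mourreG_mem_hamiltonian_domain hM hz hε₂ U h
  have key := mourreG_apply_hamiltonian hM hz hε₁ U ⟨mourreG U M ε₂ z h, hd⟩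
  rw [hH] at key
  have e : h - ((I : ℂ) * ε₂) • M (mourreG U M ε₂ z h) + z • mourreG U M ε₂ z h -
      z • mourreG U M ε₂ z h + ((I : ℂ) * ε₁) • M (mourreG U M ε₂ z h) =
      h + ((I : ℂ) * ((ε₁ - ε₂ : ℝ) : ℂ)) • M (mourreG U M ε₂ z h) := by
    rw [Complex.ofReal_sub, mul_sub, sub_smul]; abel
  rw [e, map_add, map_smul] at key
  rw [sub_apply, smul_apply, mul_apply_eq_comp,
    mul_apply_eq_comp, neg_smul]
  calc mourreG U M ε₁ z h - mourreG U M ε₂ z h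
      = mourreG U M ε₁ z h - (mourreG U M ε₁ z h +
          ((I : ℂ) * ((ε₁ - ε₂ : ℝ) : ℂ)) • mourreG U M ε₁ z (M (mourreG U M ε₂ z h))) := by
        rw [key]
    _ = -(((I : ℂ) * ((ε₁ - ε₂ : ℝ) : ℂ)) • mourreG U M ε₁ z (M (mourreG U M ε₂ z h))) := by abel

/-- **Lipschitz bound in `ε`**: `‖G_{ε₁}(z) - G_{ε₂}(z)‖ ≤ |ε₁ - ε₂| ‖M‖ / |Im z|²`.
[cite: AmreinBoutetdeMonvelGeorgescu1996, Lemma 7.3.4] -/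
theorem norm_mourreG_sub_mourreG_of_eps_le {M : H →L[ℂ] H} (hM : ∀ f : H, 0 ≤ (⟪f, M f⟫_ℂ).re)
    {z : ℂ} (hz : z.im ≠ 0) {ε₁ ε₂ : ℝ} (hε₁ : ε₁ * z.im ≤ 0) (hε₂ : ε₂ * z.im ≤ 0)
    (U : OneParameterUnitaryGroup H) :
    ‖mourreG U M ε₁ z - mourreG U M ε₂ z‖ ≤ |ε₁ - ε₂| * ‖M‖ * (|z.im|⁻¹ * |z.im|⁻¹) := by
  rw [mourreG_sub_mourreG_of_eps hM hz hε₁ hε₂ U, norm_smul, norm_neg, norm_mul, Complex.norm_I,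
    one_mul, Complex.norm_real, Real.norm_eq_abs]
  calc |ε₁ - ε₂| * ‖mourreG U M ε₁ z * M * mourreG U M ε₂ z‖
      ≤ |ε₁ - ε₂| * (‖mourreG U M ε₁ z‖ * ‖M‖ * ‖mourreG U M ε₂ z‖) := by
        gcongr
        exact (norm_mul_le _ _).trans (mul_le_mul_of_nonneg_right (norm_mul_le _ _) (norm_nonneg _))
    _ ≤ |ε₁ - ε₂| * (|z.im|⁻¹ * ‖M‖ * |z.im|⁻¹) := by
        gcongr
        · exact norm_mourreG_le hM hz hε₁ U
        · exact norm_mourreG_le hM hz hε₂ U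
    _ = |ε₁ - ε₂| * ‖M‖ * (|z.im|⁻¹ * |z.im|⁻¹) := by ring

/-! ## §5. Headline (registered helper stub) -/

/-- **First resolvent identity for Mourre's dissipative resolvent, headline form** (all binders
explicit; registered helper stub of `stub_mourreThresholdLAP`): for dissipative `M`, a real `ε` and
non-real `z₁, z₂` on the admissible side (`ε · Im zⱼ ≤ 0`),
`G_ε(z₁) - G_ε(z₂) = (z₁ - z₂) G_ε(z₁) G_ε(z₂)`. [folklore] -/
theorem mourreG_dissipative_resolvent_identity :
    ∀ (K : Type) [NormedAddCommGroup K] [InnerProductSpace ℂ K] [CompleteSpace K]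
      (U : Literature.Analysis.UnboundedOperators.OneParameterUnitaryGroup K) (M : K →L[ℂ] K)
      (ε : ℝ) (z₁ z₂ : ℂ), (∀ f : K, 0 ≤ (inner ℂ f (M f)).re) → z₁.im ≠ 0 → z₂.im ≠ 0 →
        ε * z₁.im ≤ 0 → ε * z₂.im ≤ 0 →
          Summit.AtomisticToContinuum.FouriersLaw.Theorems.MourreDissolution.mourreG U M ε z₁ -
              Summit.AtomisticToContinuum.FouriersLaw.Theorems.MourreDissolution.mourreG U M ε z₂ =
            (z₁ - z₂) •
              (Summit.AtomisticToContinuum.FouriersLaw.Theorems.MourreDissolution.mourreG U M ε z₁ *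
                Summit.AtomisticToContinuum.FouriersLaw.Theorems.MourreDissolution.mourreG U M ε z₂) := by
  intro K _ _ _ U M ε z₁ z₂ hM hz₁ hz₂ hε₁ hε₂
  exact mourreG_sub_mourreG hM hz₁ hz₂ hε₁ hε₂ U

end Summit.AtomisticToContinuum.FouriersLaw.Theorems.MourreDissolution
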